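import Mathlib
import HarnessLib
import Summits.Ventures.LatticeQCDFlow.Exactness.SampleESS

/-!
# The jackknife error of `dF = −log(pooled mean)` IS the linearised error, up to block dominance

HONEST FRAMING: exact (Metropolis-corrected) sampling algorithms for lattice gauge theory;
figures of merit are autocorrelation/cost numbers at stated couplings and volumes; no
continuum-physics claim.

Venture `LatticeQCDFlow` (cell pub-lqcd), topic `Exactness`; FANOUT row 13 (`eng-snf`, GEN-25).
NEW WORK of the cell (elementary real analysis) on the BUILT parent `Exactness/SampleESS`
(`card_mul_sum_sq_sub_sq_sum`, the pairwise form of a sum of squares); not a published result; no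
definition; nothing cited as a fact (Tukey 1958 NAMED ONLY).  Deterministic companion of GEN-25
`…ReplicaJackknifeBiasSize` (the CORRECTION is second order) and of the stochastic
`…ReplicaJackknifeDeltaMethod` (limiting coverage `L_R(q)`): here the printed ERROR itself.

WHY (row 13).  For `R ≥ 2` blocks with positive block values `y_r`, `estimators.jackknife(kind =
free_energy)` prints `dF_err² = ((R−1)/R) Σ_r (dF_{(−r)} − dF_{(·)})²` with
`dF_{(−r)} = −log ȳ_{(−r)}`, `ȳ_{(−r)} = (Σ_{s≠r} y_s)/(R−1)`, `dF_{(·)}` their mean.  Two exact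
identities — the pairwise form `Σ_r (θ_r − θ̄)² = (1/2R) Σ_r Σ_s (θ_r − θ_s)²` and
`ȳ_{(−r)} − ȳ_{(−s)} = (y_s − y_r)/(R−1)` — and the two-sided slope bound of the logarithm on
`[m, M]`, `(a − b)²/M² ≤ (log a − log b)² ≤ (a − b)²/m²`, give, whenever `m ≤ ȳ_{(−r)} ≤ M` for
all `r`:

  **`Σ_r (y_r − ȳ)²/(R(R−1)·M²) ≤ dF_err² ≤ Σ_r (y_r − ȳ)²/(R(R−1)·m²)`**
  (`le_jackknife_variance_neg_log`, `jackknife_variance_neg_log_le`),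

i.e. `(ȳ/M)²·s²_Δ ≤ dF_err² ≤ (ȳ/m)²·s²_Δ` with `s²_Δ = (Σ_r (y_r − ȳ)²/(R(R−1)))/ȳ²` the
linearised (delta-method, replica-`t` of `log`) squared standard error: the jackknife bar of the
free energy is the naive propagated bar up to the block-dominance factors `ȳ/M ≤ 1 ≤ ȳ/m`, with
NO distributional input.  Since `Σ_r (y_r − ȳ)²/(R(R−1))` is itself the (delete-one-block
jackknife = replica) variance of the POOLED MEAN `ȳ` — the engine's `Zratio_err²` up to the
common factor `e^{−2 max}` — the sandwich reads, in printed numbers,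
`Zratio_err/M′ ≤ dF_err ≤ Zratio_err/m′` with `m′ ≤ Zratio_{(−r)} ≤ M′` the extreme
leave-one-out `Z`-ratios.  (The leave-one-out means always satisfy
`m = min_r ȳ_{(−r)} ≥ (Rȳ − max_r y_r)/(R−1)`, so the factor degrades only when ONE block
carries a macroscopic share of `Σ_r y_r` — the same dominance that G25-14 flags through the bias
correction.)

* `sq_log_sub_log_le`, `sq_sub_div_le_sq_log_sub_log` — the slope sandwich of `log` on `[m, M]`;
* `sum_sq_sub_avg_eq_sum_sum` — pairwise form of a centred sum of squares;
* `looMean_sub_looMean` — `ȳ_{(−r)} − ȳ_{(−s)} = (y_s − y_r)/(R−1)`;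
* **`jackknife_variance_neg_log_le`**, **`le_jackknife_variance_neg_log`**.

NOT CLAIMED: anything stochastic; anything numerical.
-/

namespace Summit.Ventures.LatticeQCDFlow.Exactness.GeneralNCMC

open Finset Summit.Ventures.LatticeQCDFlow.Exactness

/-! ## §1 The slope sandwich of the logarithm -/

section Slope

/-- Ordered case: `(log a − log b)·m ≤ a − b` for `0 < m ≤ b ≤ a`. -/
private theorem log_sub_log_mul_le_sub {a b m : ℝ} (hm : 0 < m) (hb : m ≤ b) (hab : b ≤ a) :
    (Real.log a - Real.log b) * m ≤ a - b := by
  have hb0 : 0 < b := hm.trans_le hb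
  have ha0 : 0 < a := hb0.trans_le hab
  have h1 : Real.log a - Real.log b ≤ (a - b) / b := by
    have h := Real.log_le_sub_one_of_pos (div_pos ha0 hb0)
    rw [Real.log_div ha0.ne' hb0.ne'] at h
    have : a / b - 1 = (a - b) / b := by field_simp
    linarith
  calc (Real.log a - Real.log b) * m ≤ (a - b) / b * m :=
        mul_le_mul_of_nonneg_right h1 hm.le
    _ ≤ (a - b) / b * b := mul_le_mul_of_nonneg_left hb (div_nonneg (sub_nonneg.2 hab) hb0.le)
    _ = a - b := div_mul_cancel₀ _ hb0.ne'

/-- Ordered case: `a − b ≤ (log a − log b)·M` for `0 < b ≤ a ≤ M`. -/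
private theorem sub_le_log_sub_log_mul {a b M : ℝ} (hb0 : 0 < b) (ha : a ≤ M) (hab : b ≤ a) :
    a - b ≤ (Real.log a - Real.log b) * M := by
  have ha0 : 0 < a := hb0.trans_le hab
  have hM : 0 < M := ha0.trans_le ha
  have h1 : (a - b) / a ≤ Real.log a - Real.log b := by
    have h := Real.one_sub_inv_le_log_of_pos (div_pos ha0 hb0)
    rw [Real.log_div ha0.ne' hb0.ne', inv_div] at h
    have : 1 - b / a = (a - b) / a := by field_simp
    linarith
  calc a - b = (a - b) / a * a := (div_mul_cancel₀ _ ha0.ne').symm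
    _ ≤ (a - b) / a * M := mul_le_mul_of_nonneg_left ha (div_nonneg (sub_nonneg.2 hab) ha0.le)
    _ ≤ (Real.log a - Real.log b) * M :=
        mul_le_mul_of_nonneg_right h1 hM.le

/-- `(log a − log b)² ≤ (a − b)²/m²` for `0 < m ≤ a, b`. -/
theorem sq_log_sub_log_le {a b m : ℝ} (hm : 0 < m) (ha : m ≤ a) (hb : m ≤ b) :
    (Real.log a - Real.log b) ^ 2 ≤ (a - b) ^ 2 / m ^ 2 := by
  rw [le_div_iff₀ (by positivity), ← mul_pow]
  rcases le_total b a with hab | hab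
  · exact pow_le_pow_left₀ (mul_nonneg (sub_nonneg.2 (Real.log_le_log (hm.trans_le hb) hab))
      hm.le) (log_sub_log_mul_le_sub hm hb hab) 2
  · have h := pow_le_pow_left₀ (mul_nonneg (sub_nonneg.2 (Real.log_le_log (hm.trans_le ha)
      hab)) hm.le) (log_sub_log_mul_le_sub hm ha hab) 2
    calc ((Real.log a - Real.log b) * m) ^ 2 = ((Real.log b - Real.log a) * m) ^ 2 := by ring
      _ ≤ (b - a) ^ 2 := h
      _ = (a - b) ^ 2 := by ring

/-- `(a − b)²/M² ≤ (log a − log b)²` for `0 < a, b ≤ M`. -/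
theorem sq_sub_div_le_sq_log_sub_log {a b M : ℝ} (ha0 : 0 < a) (hb0 : 0 < b) (ha : a ≤ M)
    (hb : b ≤ M) :
    (a - b) ^ 2 / M ^ 2 ≤ (Real.log a - Real.log b) ^ 2 := by
  have hM : 0 < M := ha0.trans_le ha
  rw [div_le_iff₀ (by positivity), ← mul_pow]
  rcases le_total b a with hab | hab
  · exact pow_le_pow_left₀ (sub_nonneg.2 hab) (sub_le_log_sub_log_mul hb0 ha hab) 2
  · have h := pow_le_pow_left₀ (sub_nonneg.2 hab) (sub_le_log_sub_log_mul ha0 hb hab) 2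
    calc (a - b) ^ 2 = (b - a) ^ 2 := by ring
      _ ≤ ((Real.log b - Real.log a) * M) ^ 2 := h
      _ = ((Real.log a - Real.log b) * M) ^ 2 := by ring

end Slope

/-! ## §2 Two exact identities -/

section Identities

variable {ι : Type*} [Fintype ι]

/-- **Pairwise form of a centred sum of squares**:
`Σ_r (θ_r − (Σθ)/R)² = (Σ_r Σ_s (θ_r − θ_s)²)/(2R)` (`R ≥ 1`). -/
theorem sum_sq_sub_avg_eq_sum_sum [Nonempty ι] (θ : ι → ℝ) :
    ∑ r, (θ r - (∑ s, θ s) / Fintype.card ι) ^ 2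
      = (∑ r, ∑ s, (θ r - θ s) ^ 2) / (2 * Fintype.card ι) := by
  have hR : (Fintype.card ι : ℝ) ≠ 0 := by positivity
  have hpair := card_mul_sum_sq_sub_sq_sum θ
  -- `Σ (θ_r − c)² = Σ θ² − 2c Σθ + R c²`
  have hexp : ∀ r, (θ r - (∑ s, θ s) / Fintype.card ι) ^ 2
      = θ r ^ 2 - 2 * ((∑ s, θ s) / Fintype.card ι) * θ r
          + ((∑ s, θ s) / Fintype.card ι) ^ 2 := fun r => by ring
  simp_rw [hexp, sum_add_distrib, sum_sub_distrib, ← mul_sum, sum_const, card_univ, nsmul_eq_mul]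
  rw [eq_div_iff (by positivity)]
  have h2 : ∑ r, ∑ s, (θ r - θ s) ^ 2
      = 2 * ((Fintype.card ι : ℝ) * ∑ i, θ i ^ 2 - (∑ i, θ i) ^ 2) := by
    rw [hpair]; ring
  rw [h2]
  field_simp
  ring

variable [DecidableEq ι]

/-- **`ȳ_{(−r)} − ȳ_{(−s)} = (y_s − y_r)/(R−1)`**. -/
theorem looMean_sub_looMean (y : ι → ℝ) (r s : ι) :
    (∑ t ∈ univ.erase r, y t) / ((Fintype.card ι : ℝ) - 1)
        - (∑ t ∈ univ.erase s, y t) / ((Fintype.card ι : ℝ) - 1)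
      = (y s - y r) / ((Fintype.card ι : ℝ) - 1) := by
  rw [sum_erase_eq_sub (mem_univ r), sum_erase_eq_sub (mem_univ s)]
  ring

end Identities

/-! ## §3 The sandwich for the printed `dF_err²` -/

section Sandwich

variable {ι : Type*} [Fintype ι] [DecidableEq ι]

/-- **`dF_err² ≤ Σ_r (y_r − ȳ)²/(R(R−1)·m²)`** when every leave-one-out mean is `≥ m > 0`
(`R ≥ 2`; `loo r = ȳ_{(−r)}` and `ybar = ȳ` passed with their defining equations). -/
theorem jackknife_variance_neg_log_le (hR : 2 ≤ Fintype.card ι) {y : ι → ℝ} {ybar : ℝ}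
    {loo : ι → ℝ} (hbar : ybar = (∑ r, y r) / Fintype.card ι)
    (hloo : ∀ r, loo r = (∑ s ∈ univ.erase r, y s) / ((Fintype.card ι : ℝ) - 1))
    {m : ℝ} (hm : 0 < m) (hmle : ∀ r, m ≤ loo r) :
    ((Fintype.card ι : ℝ) - 1) / Fintype.card ι
          * ∑ r, (-Real.log (loo r) - (∑ s, -Real.log (loo s)) / Fintype.card ι) ^ 2
      ≤ (∑ r, (y r - ybar) ^ 2) / ((Fintype.card ι : ℝ) * ((Fintype.card ι : ℝ) - 1) * m ^ 2) := by
  have hRpos : 0 < Fintype.card ι := by omega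
  haveI : Nonempty ι := Fintype.card_pos_iff.mp hRpos
  have hR0 : (0 : ℝ) < Fintype.card ι := by exact_mod_cast hRpos
  have hR1 : (0 : ℝ) < (Fintype.card ι : ℝ) - 1 := by
    have : (2 : ℝ) ≤ Fintype.card ι := by exact_mod_cast hR
    linarith
  -- pairwise forms on both sides
  rw [sum_sq_sub_avg_eq_sum_sum, hbar, sum_sq_sub_avg_eq_sum_sum y]
  -- termwise: `(−log a + log b)² ≤ (a − b)²/m² = (y_s − y_r)²/((R−1)² m²)`
  have hterm : ∀ r s, (-Real.log (loo r) - -Real.log (loo s)) ^ 2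
      ≤ (y r - y s) ^ 2 / (((Fintype.card ι : ℝ) - 1) ^ 2 * m ^ 2) := fun r s => by
    have h := sq_log_sub_log_le hm (hmle s) (hmle r)
    have hd : loo s - loo r = (y r - y s) / ((Fintype.card ι : ℝ) - 1) := by
      rw [hloo s, hloo r, looMean_sub_looMean]
    rw [hd, div_pow, div_div] at h
    calc (-Real.log (loo r) - -Real.log (loo s)) ^ 2
        = (Real.log (loo s) - Real.log (loo r)) ^ 2 := by ring
      _ ≤ _ := h
  have hsum : ∑ r, ∑ s, (-Real.log (loo r) - -Real.log (loo s)) ^ 2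
      ≤ ∑ r, ∑ s, (y r - y s) ^ 2 / (((Fintype.card ι : ℝ) - 1) ^ 2 * m ^ 2) :=
    sum_le_sum fun r _ => sum_le_sum fun s _ => hterm r s
  simp_rw [← sum_div] at hsum
  calc ((Fintype.card ι : ℝ) - 1) / Fintype.card ι
          * ((∑ r, ∑ s, (-Real.log (loo r) - -Real.log (loo s)) ^ 2) / (2 * Fintype.card ι))
      ≤ ((Fintype.card ι : ℝ) - 1) / Fintype.card ι
          * ((∑ r, ∑ s, (y r - y s) ^ 2) / (((Fintype.card ι : ℝ) - 1) ^ 2 * m ^ 2)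
              / (2 * Fintype.card ι)) :=
        mul_le_mul_of_nonneg_left (div_le_div_of_nonneg_right hsum (by positivity))
          (by positivity)
    _ = (∑ r, ∑ s, (y r - y s) ^ 2) / (2 * Fintype.card ι)
          / ((Fintype.card ι : ℝ) * ((Fintype.card ι : ℝ) - 1) * m ^ 2) := by
        field_simp

/-- **`Σ_r (y_r − ȳ)²/(R(R−1)·M²) ≤ dF_err²`** when every leave-one-out mean is `≤ M` (and the
block values are positive, so the means are positive; `R ≥ 2`). -/
theorem le_jackknife_variance_neg_log (hR : 2 ≤ Fintype.card ι) {y : ι → ℝ} (hy : ∀ r, 0 < y r)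
    {ybar : ℝ} {loo : ι → ℝ} (hbar : ybar = (∑ r, y r) / Fintype.card ι)
    (hloo : ∀ r, loo r = (∑ s ∈ univ.erase r, y s) / ((Fintype.card ι : ℝ) - 1))
    {M : ℝ} (hMle : ∀ r, loo r ≤ M) :
    (∑ r, (y r - ybar) ^ 2) / ((Fintype.card ι : ℝ) * ((Fintype.card ι : ℝ) - 1) * M ^ 2)
      ≤ ((Fintype.card ι : ℝ) - 1) / Fintype.card ι
          * ∑ r, (-Real.log (loo r) - (∑ s, -Real.log (loo s)) / Fintype.card ι) ^ 2 := by
  have hRpos : 0 < Fintype.card ι := by omega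
  haveI : Nonempty ι := Fintype.card_pos_iff.mp hRpos
  have hR0 : (0 : ℝ) < Fintype.card ι := by exact_mod_cast hRpos
  have hR1 : (0 : ℝ) < (Fintype.card ι : ℝ) - 1 := by
    have : (2 : ℝ) ≤ Fintype.card ι := by exact_mod_cast hR
    linarith
  have hne : ∀ r : ι, ((univ : Finset ι).erase r).Nonempty := fun r => by
    rw [← Finset.card_pos, card_erase_of_mem (mem_univ r), card_univ]; omega
  have hloo_pos : ∀ r, 0 < loo r := fun r => by
    rw [hloo r]; exact div_pos (sum_pos (fun s _ => hy s) (hne r)) hR1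
  have hM : 0 < M := (hloo_pos (Classical.arbitrary ι)).trans_le (hMle _)
  rw [sum_sq_sub_avg_eq_sum_sum, hbar, sum_sq_sub_avg_eq_sum_sum y]
  have hterm : ∀ r s, (y r - y s) ^ 2 / (((Fintype.card ι : ℝ) - 1) ^ 2 * M ^ 2)
      ≤ (-Real.log (loo r) - -Real.log (loo s)) ^ 2 := fun r s => by
    have h := sq_sub_div_le_sq_log_sub_log (hloo_pos s) (hloo_pos r) (hMle s) (hMle r)
    have hd : loo s - loo r = (y r - y s) / ((Fintype.card ι : ℝ) - 1) := by
      rw [hloo s, hloo r, looMean_sub_looMean]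
    rw [hd, div_pow, div_div] at h
    calc _ ≤ _ := h
      _ = (-Real.log (loo r) - -Real.log (loo s)) ^ 2 := by ring
  have hsum : ∑ r, ∑ s, (y r - y s) ^ 2 / (((Fintype.card ι : ℝ) - 1) ^ 2 * M ^ 2)
      ≤ ∑ r, ∑ s, (-Real.log (loo r) - -Real.log (loo s)) ^ 2 :=
    sum_le_sum fun r _ => sum_le_sum fun s _ => hterm r s
  simp_rw [← sum_div] at hsum
  calc (∑ r, ∑ s, (y r - y s) ^ 2) / (2 * Fintype.card ι)
          / ((Fintype.card ι : ℝ) * ((Fintype.card ι : ℝ) - 1) * M ^ 2)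
      = ((Fintype.card ι : ℝ) - 1) / Fintype.card ι
          * ((∑ r, ∑ s, (y r - y s) ^ 2) / (((Fintype.card ι : ℝ) - 1) ^ 2 * M ^ 2)
              / (2 * Fintype.card ι)) := by
        field_simp
    _ ≤ ((Fintype.card ι : ℝ) - 1) / Fintype.card ι
          * ((∑ r, ∑ s, (-Real.log (loo r) - -Real.log (loo s)) ^ 2) / (2 * Fintype.card ι)) :=
        mul_le_mul_of_nonneg_left (div_le_div_of_nonneg_right hsum (by positivity))
          (by positivity)

end Sandwich

end Summit.Ventures.LatticeQCDFlow.Exactness.GeneralNCMC
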